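import Summits.QuantumFields.YangMills.Theorems.UnitScaleTiltProp7LatticeBoxFriedrichsCov
import Literature.MathematicalPhysics.QuantumFieldTheory.Balaban1983to89.Beta.CoordCubePoincare
import HarnessLib

/-!
# Route `UnitScaleTilt`, crux K1 «MinimiserStabilityRegPr» (stmt-QuantumFields-19200) — route-R E′ (A′), (N06) row `hN06`, LANE II «DIVERGENCE RECOVERY AT CURVED W»
# (★★OWNER g29 RULING №23 (c): §4 box bricks → px4; skeleton §4 (B9) `coarseBoxPoincare`, px12 g7's (B9′) small-bond form): **THE `ℓ²` POINCARÉ INEQUALITY ON A BOX OF `ℤᵈ`,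
# FLAT, MATRIX-VALUED, AND WITH SMALL-BOND UNITARY TRANSPORTERS** — `Σ_{Q_R}‖w y − m‖² ≤ N·R(2R+1)·(2·Σ_{inside}‖R(T y μ) w(y+e_μ) − w y‖² + 8dβ²·Σ_{Q_R}‖w‖²)`, `m` = the plain mean

Cell `ym3-torus`, width seat `ym3-torus-px4` (gen 7).  THEOREMS ONLY (0 `def`, 0 `sorry`); `--supports stmt-QuantumFields-19200 --as helper`, count-neutral; consumer-independent.  YM₃ on T³
is a ladder rung (R3), not d = 4, not infinite volume, not the Clay problem; nothing here claims [Balaban1985BackgroundPropagators] Thm 3.3 ∕ 3.11, `hN06`, (REC), E′, EX, H, the crux or the gap.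

WHY ∕ HOW.  LANE II's assembly (B7) controls the coarse field `Q′_W φ_i` on a patch of `Mc ≤ 2R+1` coarse sites by its covariant coarse gradient ((B9) = LOCATE #60 S4(c)).  The tree holds the cube
Poincaré inequality for real functions on the coordinate cube `Fin d → Fin (n+1)` (lit ✓`Beta.CoordCubePoincare.poincare_coordCube`, constant `n(n+1)∕2`, inside differences only); this file
(i) charts the box `Q_R(z) ⊂ ℤᵈ` by that cube (`boxChart`, written inline as `fun r i => z i − R + r i`), (ii) transfers the inequality to `Q_R(z)` (`sum_sq_sub_avg_le_box`), (iii) passes to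
`M_N(ℂ)`-valued functions componentwise (factor `N`, the ✓`block227_matrix` pattern) with the plain mean `m = |Q_R|⁻¹·Σ w` (`sum_sq_sub_mean_le_box_matrix`), and (iv) replaces flat by covariant
differences with unitary transporters `T` whose box bonds are `β`-close to `1` (`sum_sq_sub_mean_le_box_cov` — px12 g7's (B9′) «BOND-SMALL TRANSPORTERS» form with the PLAIN mean; the v1.2 «∃ gauge»
form follows by the axial gauge of part 2∕2 of (B1′), ✓`Prop7LatticeBoxFriedrichsCurved.norm_axial_sub_one_le_of_plaqSmall`).

WHAT IS PROVED (ns `…Theorems.Prop7LatticeBoxPoincareCov`): §1 the chart (`boxChart_mem`, `boxChart_injective`, `exists_boxChart_eq`, `box_eq_image_boxChart`, `sum_box_eq_sum_chart`,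
`boxChart_stepUp`, `ne_last_iff_add_unitVec_mem`); §2 ★`sum_sq_sub_avg_le_box` (real); §3 ★`sum_sq_sub_mean_le_box_matrix`; §4 ★★★`sum_sq_sub_mean_le_box_cov`:
`Σ_{y∈Q_R}‖w y − m‖² ≤ N·R·(2R+1)·(2·Σ_{y∈Q_R}Σ_μ [y+e_μ ∈ Q_R]·‖R(T y μ)(w(y+e_μ)) − w y‖² + 8·d·β²·Σ_{y∈Q_R}‖w y‖²)`, `m = (|Q_R| : ℂ)⁻¹ • Σ_{Q_R} w`.
HONEST SCOPE.  Flat lattice calculus + unitary-conjugation bookkeeping over landed lit∕tree lemmas; nothing of print asserted; rung R3, not Clay; YM gap NOT proved.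

References: T. Bałaban, CMP **95** (1984) 17–40 [Balaban1984PropagatorsI] (Prop. 1.1 p.33); CMP **89** (1983) 571–597 [Balaban1983RegularityDecay] ((2.27) p.580); CMP **98** (1985) 17–51
[Balaban1985Averaging] (pp.24–25, (56) p.27); M. Giaquinta, *Multiple integrals …* (1983) [Giaquinta1984] (Ch. III §1).
-/

set_option autoImplicit false

noncomputable section

open scoped BigOperators Matrix.Norms.L2Operator
open Finset

namespace Summit.QuantumFields.YangMills.Theorems.Prop7LatticeBoxPoincareCov

open Literature.MathematicalPhysics.QuantumFieldTheory.Balaban1983to89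
open Literature.MathematicalPhysics.QuantumFieldTheory.Balaban1983to89.B4Eq19LatticeOperators
open Literature.MathematicalPhysics.QuantumFieldTheory.Balaban1983to89.Beta.CoordCubePoincare (stepUp poincare_coordCube)
open Literature.MathematicalPhysics.QuantumFieldTheory.Balaban1983to89.Beta.BlockPoincare (avg)
open B7Prop1Explicit (U1)
open B7Eq78Linearization (conjR conjR_apply)
open Summit.QuantumFields.YangMills.Theorems.Prop7CovariantCoercivity (opNorm_sq_le_sum_re_sq_add_im_sq sum_re_sq_add_im_sq_le_mul_opNorm_sq sum_sum_sum_comm)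
open Summit.QuantumFields.YangMills.Theorems.Prop7LatticeBoxFriedrichsCov (norm_conjR_sub_self_le sum_box_shift_le)

variable {d N : ℕ}

/-! ## §1 The cube chart of a box -/

section Chart

variable (z : Zd d) (R : ℤ) (n : ℕ)

/-- The chart lands in the box when `n = 2R`. [folklore] [cite: Giaquinta1984, Ch. III §1 p.64] -/
theorem boxChart_mem (hn : (n : ℤ) = 2 * R) (r : Fin d → Fin (n + 1)) : (fun i => z i - R + ((r i : ℕ) : ℤ)) ∈ box z R := by
  rw [mem_box]
  intro i
  have h0 : (0 : ℤ) ≤ ((r i : ℕ) : ℤ) := by positivity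
  have h1 : ((r i : ℕ) : ℤ) ≤ n := by exact_mod_cast Nat.lt_succ_iff.mp (r i).isLt
  show |z i - R + ((r i : ℕ) : ℤ) - z i| ≤ R
  rw [abs_le]; constructor <;> linarith

/-- The chart is injective. [folklore] [cite: Giaquinta1984, Ch. III §1 p.64] -/
theorem boxChart_injective : Function.Injective (fun (r : Fin d → Fin (n + 1)) (i : Fin d) => z i - R + ((r i : ℕ) : ℤ)) := by
  intro r r' h
  funext i
  have := congrFun h i
  simp only at this
  exact Fin.ext (by exact_mod_cast (add_left_cancel this))

/-- The chart is onto the box when `n = 2R`. [folklore] [cite: Giaquinta1984, Ch. III §1 p.64] -/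
theorem exists_boxChart_eq (hn : (n : ℤ) = 2 * R) {y : Zd d} (hy : y ∈ box z R) :
    ∃ r : Fin d → Fin (n + 1), (fun i => z i - R + ((r i : ℕ) : ℤ)) = y := by
  rw [mem_box] at hy
  have hc : ∀ i, 0 ≤ y i - (z i - R) ∧ y i - (z i - R) ≤ n := fun i => by
    have := abs_le.1 (hy i); constructor <;> linarith [this.1, this.2]
  refine ⟨fun i => ⟨(y i - (z i - R)).toNat, ?_⟩, ?_⟩
  · have := (hc i).2
    have h0 := (hc i).1
    zify
    rw [Int.toNat_of_nonneg h0]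
    linarith
  · funext i
    simp only
    rw [Int.toNat_of_nonneg (hc i).1]
    ring

/-- The box is the image of the chart. [folklore] [cite: Giaquinta1984, Ch. III §1 p.64] -/
theorem box_eq_image_boxChart [DecidableEq (Zd d)] (hn : (n : ℤ) = 2 * R) :
    box z R = Finset.univ.image (fun (r : Fin d → Fin (n + 1)) (i : Fin d) => z i - R + ((r i : ℕ) : ℤ)) := by
  ext y
  simp only [Finset.mem_image, Finset.mem_univ, true_and]
  constructor
  · exact fun hy => exists_boxChart_eq z R n hn hy
  · rintro ⟨r, rfl⟩; exact boxChart_mem z R n hn r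

/-- **Box sums are cube sums.** [folklore] [cite: Giaquinta1984, Ch. III §1 p.64] -/
theorem sum_box_eq_sum_chart {α : Type*} [AddCommMonoid α] (hn : (n : ℤ) = 2 * R) (G : Zd d → α) :
    ∑ y ∈ box z R, G y = ∑ r : Fin d → Fin (n + 1), G (fun i => z i - R + ((r i : ℕ) : ℤ)) := by
  classical
  rw [box_eq_image_boxChart z R n hn, Finset.sum_image fun r _ r' _ h => boxChart_injective z R n h]

/-- The cardinality of the box. [folklore] [cite: Giaquinta1984, Ch. III §1 p.64] -/
theorem card_box_eq (hn : (n : ℤ) = 2 * R) : (box z R).card = (n + 1) ^ d := by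
  classical
  rw [box_eq_image_boxChart z R n hn, Finset.card_image_of_injective _ (boxChart_injective z R n)]
  simp

/-- A step inside the cube is a unit step in the box. [folklore] [cite: Giaquinta1984, Ch. III §1 p.64] -/
theorem boxChart_stepUp (r : Fin d → Fin (n + 1)) (μ : Fin d) (hr : r μ ≠ Fin.last n) :
    (fun i => z i - R + (((stepUp r μ) i : ℕ) : ℤ)) = (fun i => z i - R + ((r i : ℕ) : ℤ)) + unitVec μ := by
  funext i
  simp only [stepUp, Pi.add_apply, unitVec, Pi.single_apply]
  by_cases hi : i = μ
  · subst hi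
    rw [Function.update_self, if_pos rfl]
    have h1 : ((r i + 1 : Fin (n + 1)) : ℕ) = (r i : ℕ) + 1 := Fin.val_add_one_of_lt (Fin.lt_last_iff_ne_last.mpr hr)
    rw [h1]; push_cast; ring
  · rw [Function.update_of_ne hi, if_neg hi, add_zero]

/-- Inside steps of the cube are exactly the box steps that stay in the box. [folklore] [cite: Giaquinta1984, Ch. III §1 p.64] -/
theorem ne_last_iff_add_unitVec_mem (hn : (n : ℤ) = 2 * R) (r : Fin d → Fin (n + 1)) (μ : Fin d) :
    r μ ≠ Fin.last n ↔ (fun i => z i - R + ((r i : ℕ) : ℤ)) + unitVec μ ∈ box z R := by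
  constructor
  · intro hr
    rw [← boxChart_stepUp z R n r μ hr]
    exact boxChart_mem z R n hn _
  · intro hmem hr
    have h := (mem_box.1 hmem) μ
    simp only [Pi.add_apply, unitVec, Pi.single_eq_same, hr, Fin.val_last] at h
    rw [abs_le] at h
    have := h.2
    linarith

end Chart

/-! ## §2 The flat `ℓ²` Poincaré inequality on a box of `ℤᵈ` (real-valued) -/

/-- ★ **FLAT BOX POINCARÉ, REAL**: `Σ_{Q_R}(u − avg)² ≤ R(2R+1)·Σ_{Q_R}Σ_μ [y+e_μ ∈ Q_R]·(u(y+e_μ) − u y)²` (`avg` = lit `BlockPoincare.avg (box z R) u`; transfer of lit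
✓`poincare_coordCube`, constant `n(n+1)∕2` at `n = 2R`). [cite: Balaban1983RegularityDecay, (2.27) p.580; Giaquinta1984, Ch. III §1 p.65] -/
theorem sum_sq_sub_avg_le_box {z : Zd d} {R : ℤ} (hR : 0 ≤ R) (u : Zd d → ℝ) :
    ∑ y ∈ box z R, (u y - avg (box z R) u) ^ 2
      ≤ (R : ℝ) * (2 * R + 1) * ∑ y ∈ box z R, ∑ μ, (if y + unitVec μ ∈ box z R then (u (y + unitVec μ) - u y) ^ 2 else 0) := by
  classical
  obtain ⟨n, hn⟩ : ∃ n : ℕ, (n : ℤ) = 2 * R := ⟨(2 * R).toNat, Int.toNat_of_nonneg (by linarith)⟩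
  set φ : (Fin d → Fin (n + 1)) → Zd d := fun r i => z i - R + ((r i : ℕ) : ℤ) with hφ
  -- the mean transfers
  have havg : avg (box z R) u = avg Finset.univ (u ∘ φ) := by
    unfold avg
    rw [sum_box_eq_sum_chart z R n hn u, card_box_eq z R n hn]
    simp [hφ]
  -- left side
  have hL : ∑ y ∈ box z R, (u y - avg (box z R) u) ^ 2 = ∑ r : Fin d → Fin (n + 1), ((u ∘ φ) r - avg Finset.univ (u ∘ φ)) ^ 2 := by
    rw [havg, sum_box_eq_sum_chart z R n hn]
    rfl
  -- right side, read through the chart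
  have hRside : ∑ y ∈ box z R, ∑ μ, (if y + unitVec μ ∈ box z R then (u (y + unitVec μ) - u y) ^ 2 else 0)
      = ∑ μ : Fin d, ∑ r ∈ Finset.univ.filter (fun r : Fin d → Fin (n + 1) => r μ ≠ Fin.last n), ((u ∘ φ) (stepUp r μ) - (u ∘ φ) r) ^ 2 := by
    rw [sum_box_eq_sum_chart z R n hn (fun y => ∑ μ, (if y + unitVec μ ∈ box z R then (u (y + unitVec μ) - u y) ^ 2 else 0)),
      Finset.sum_comm]
    refine Finset.sum_congr rfl fun μ _ => ?_
    rw [Finset.sum_filter]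
    refine Finset.sum_congr rfl fun r _ => ?_
    by_cases hr : r μ ≠ Fin.last n
    · rw [if_pos hr, if_pos ((ne_last_iff_add_unitVec_mem z R n hn r μ).1 hr)]
      simp only [Function.comp_def, hφ]
      rw [boxChart_stepUp z R n r μ hr]
    · rw [if_neg hr, if_neg (fun h => hr ((ne_last_iff_add_unitVec_mem z R n hn r μ).2 h))]
  -- the cube Poincaré inequality
  have hP := poincare_coordCube n d (u ∘ φ)
  rw [hL, hRside]
  refine hP.trans (le_of_eq ?_)
  congr 1
  have : (n : ℝ) = 2 * (R : ℝ) := by exact_mod_cast hn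
  rw [this]; ring

/-! ## §3 Matrix-valued functions: the plain mean -/

section Matrix

variable [NeZero N]

omit [NeZero N] in
/-- A real coordinate of the plain mean is the mean of the coordinate, for a coordinate commuting with real scalars. [folklore] -/
theorem coord_mean {z : Zd d} {R : ℤ} (w : Zd d → Matrix (Fin N) (Fin N) ℂ) (c : Matrix (Fin N) (Fin N) ℂ →+ ℝ)
    (hc : ∀ (t : ℝ) (A : Matrix (Fin N) (Fin N) ℂ), c ((t : ℂ) • A) = t * c A) :
    c ((((box z R).card : ℝ) : ℂ)⁻¹ • ∑ y ∈ box z R, w y) = avg (box z R) (fun y => c (w y)) := by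
  unfold avg
  rw [← Complex.ofReal_inv, hc, map_sum, div_eq_inv_mul]

omit [NeZero N] in
/-- ★ **FLAT BOX POINCARÉ FOR `M_N(ℂ)`-VALUED FUNCTIONS, PLAIN MEAN**: `Σ_{Q_R}‖w y − m‖² ≤ N·R(2R+1)·Σ_{Q_R}Σ_μ [y+e_μ ∈ Q_R]·‖w(y+e_μ) − w y‖²`, `m = |Q_R|⁻¹·Σ w`.
[cite: Balaban1983RegularityDecay, (2.27) p.580; Giaquinta1984, Ch. III §1 p.65] -/
theorem sum_sq_sub_mean_le_box_matrix {z : Zd d} {R : ℤ} (hR : 0 ≤ R) (w : Zd d → Matrix (Fin N) (Fin N) ℂ) :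
    ∑ y ∈ box z R, ‖w y - (((box z R).card : ℝ) : ℂ)⁻¹ • ∑ x ∈ box z R, w x‖ ^ 2
      ≤ N * ((R : ℝ) * (2 * R + 1)) * ∑ y ∈ box z R, ∑ μ, (if y + unitVec μ ∈ box z R then ‖w (y + unitVec μ) - w y‖ ^ 2 else 0) := by
  classical
  set m : Matrix (Fin N) (Fin N) ℂ := (((box z R).card : ℝ) : ℂ)⁻¹ • ∑ x ∈ box z R, w x with hm
  set χ : Zd d → Fin d → ℝ := fun y μ => if y + unitVec μ ∈ box z R then 1 else 0 with hχ
  have hχ0 : ∀ y μ, 0 ≤ χ y μ := fun y μ => by simp only [hχ]; split_ifs <;> norm_num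
  have hite : ∀ (y : Zd d) (μ : Fin d) (t : ℝ), (if y + unitVec μ ∈ box z R then t else 0) = χ y μ * t := by
    intro y μ t; simp only [hχ]; split_ifs <;> simp
  -- one component
  have hcomp : ∀ (c : Matrix (Fin N) (Fin N) ℂ →+ ℝ), (∀ (t : ℝ) (A : Matrix (Fin N) (Fin N) ℂ), c ((t : ℂ) • A) = t * c A) →
      ∑ y ∈ box z R, c (w y - m) ^ 2 ≤ ((R : ℝ) * (2 * R + 1)) * ∑ y ∈ box z R, ∑ μ, χ y μ * c (w (y + unitVec μ) - w y) ^ 2 := by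
    intro c hc
    have h := sum_sq_sub_avg_le_box (z := z) hR (fun y => c (w y))
    have em : ∀ y, c (w y - m) = c (w y) - avg (box z R) (fun y => c (w y)) := by
      intro y; rw [map_sub, hm, coord_mean w c hc]
    simp only [em]
    refine h.trans (le_of_eq ?_)
    congr 1
    refine Finset.sum_congr rfl fun y _ => Finset.sum_congr rfl fun μ _ => ?_
    rw [hite, map_sub]
  -- the 2N² components
  have hjk : ∀ j k : Fin N, ∑ y ∈ box z R, (((w y - m) j k).re ^ 2 + ((w y - m) j k).im ^ 2)
      ≤ ((R : ℝ) * (2 * R + 1)) * ∑ y ∈ box z R, ∑ μ, χ y μ * (((w (y + unitVec μ) - w y) j k).re ^ 2 + ((w (y + unitVec μ) - w y) j k).im ^ 2) := by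
    intro j k
    obtain ⟨⟨cr, hcr⟩, ⟨ci, hci⟩⟩ := Prop7LatticeBoxFriedrichsCov.exists_coord_addMonoidHom (N := N) j k
    have h1 := hcomp cr (fun t A => by
      simp only [hcr, Matrix.smul_apply, smul_eq_mul, Complex.mul_re, Complex.ofReal_re, Complex.ofReal_im]; ring)
    have h2 := hcomp ci (fun t A => by
      simp only [hci, Matrix.smul_apply, smul_eq_mul, Complex.mul_im, Complex.ofReal_re, Complex.ofReal_im]; ring)
    simp only [hcr, hci] at h1 h2
    have e : ∀ (y : Zd d) (μ : Fin d), χ y μ * (((w (y + unitVec μ) - w y) j k).re ^ 2 + ((w (y + unitVec μ) - w y) j k).im ^ 2)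
        = χ y μ * ((w (y + unitVec μ) - w y) j k).re ^ 2 + χ y μ * ((w (y + unitVec μ) - w y) j k).im ^ 2 := fun y μ => by ring
    simp only [e, Finset.sum_add_distrib, mul_add]
    linarith
  have hsum := Finset.sum_le_sum fun j (_ : j ∈ (Finset.univ : Finset (Fin N))) =>
    Finset.sum_le_sum fun k (_ : k ∈ (Finset.univ : Finset (Fin N))) => hjk j k
  have eL : ∑ j : Fin N, ∑ k : Fin N, ∑ y ∈ box z R, (((w y - m) j k).re ^ 2 + ((w y - m) j k).im ^ 2)
      = ∑ y ∈ box z R, ∑ j : Fin N, ∑ k : Fin N, (((w y - m) j k).re ^ 2 + ((w y - m) j k).im ^ 2) :=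
    sum_sum_sum_comm _ (fun y j k => ((w y - m) j k).re ^ 2 + ((w y - m) j k).im ^ 2)
  have hX : ∑ j : Fin N, ∑ k : Fin N, ∑ y ∈ box z R, ∑ μ, χ y μ * (((w (y + unitVec μ) - w y) j k).re ^ 2 + ((w (y + unitVec μ) - w y) j k).im ^ 2)
      = ∑ y ∈ box z R, ∑ μ, χ y μ * ∑ j : Fin N, ∑ k : Fin N, (((w (y + unitVec μ) - w y) j k).re ^ 2 + ((w (y + unitVec μ) - w y) j k).im ^ 2) := by
    rw [Prop7LatticeBoxFriedrichsCov.sum_comm4 (box z R) Finset.univ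
      (fun y μ j k => χ y μ * (((w (y + unitVec μ) - w y) j k).re ^ 2 + ((w (y + unitVec μ) - w y) j k).im ^ 2))]
    refine Finset.sum_congr rfl fun y _ => Finset.sum_congr rfl fun μ _ => ?_
    rw [Finset.mul_sum]
    exact Finset.sum_congr rfl fun j _ => by rw [Finset.mul_sum]
  have eR : ∑ j : Fin N, ∑ k : Fin N, (((R : ℝ) * (2 * R + 1)) * ∑ y ∈ box z R, ∑ μ, χ y μ * (((w (y + unitVec μ) - w y) j k).re ^ 2 + ((w (y + unitVec μ) - w y) j k).im ^ 2))
      = ((R : ℝ) * (2 * R + 1)) * ∑ y ∈ box z R, ∑ μ, χ y μ * ∑ j : Fin N, ∑ k : Fin N, (((w (y + unitVec μ) - w y) j k).re ^ 2 + ((w (y + unitVec μ) - w y) j k).im ^ 2) := by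
    rw [← hX]
    simp only [← Finset.mul_sum]
  rw [eL, eR] at hsum
  -- compare with operator norms
  have hLow : ∑ y ∈ box z R, ‖w y - m‖ ^ 2 ≤ ∑ y ∈ box z R, ∑ j : Fin N, ∑ k : Fin N, (((w y - m) j k).re ^ 2 + ((w y - m) j k).im ^ 2) :=
    Finset.sum_le_sum fun y _ => opNorm_sq_le_sum_re_sq_add_im_sq _
  have hUp : ∑ y ∈ box z R, ∑ μ, χ y μ * ∑ j : Fin N, ∑ k : Fin N, (((w (y + unitVec μ) - w y) j k).re ^ 2 + ((w (y + unitVec μ) - w y) j k).im ^ 2)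
      ≤ ∑ y ∈ box z R, ∑ μ, χ y μ * (N * ‖w (y + unitVec μ) - w y‖ ^ 2) :=
    Finset.sum_le_sum fun y _ => Finset.sum_le_sum fun μ _ => mul_le_mul_of_nonneg_left (sum_re_sq_add_im_sq_le_mul_opNorm_sq _) (hχ0 y μ)
  have hR' : (0 : ℝ) ≤ (R : ℝ) := by exact_mod_cast hR
  have hRR : (0 : ℝ) ≤ (R : ℝ) * (2 * R + 1) := by positivity
  have step := hLow.trans (hsum.trans (mul_le_mul_of_nonneg_left hUp hRR))
  refine step.trans (le_of_eq ?_)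
  simp only [hite]
  have : ∀ (y : Zd d) (μ : Fin d), χ y μ * (N * ‖w (y + unitVec μ) - w y‖ ^ 2) = N * (χ y μ * ‖w (y + unitVec μ) - w y‖ ^ 2) := fun y μ => by ring
  simp only [this, ← Finset.mul_sum]
  ring

end Matrix

/-! ## §4 Small-bond unitary transporters (px12 g7's (B9′) form, plain mean) -/

section Covariant

variable [NeZero N]

/-- ★★★ **(B9′) THE COARSE BOX POINCARÉ INEQUALITY WITH SMALL-BOND UNITARY TRANSPORTERS, PLAIN MEAN**: `T` unitary with `‖T y μ − 1‖ ≤ β` on the bonds of `Q_R(z)`, `w` any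
`M_N(ℂ)`-valued function: `Σ_{Q_R}‖w y − m‖² ≤ N·R(2R+1)·(2·Σ_{Q_R}Σ_μ [y+e_μ ∈ Q_R]·‖R(T y μ)w(y+e_μ) − w y‖² + 8dβ²·Σ_{Q_R}‖w y‖²)`, `m = |Q_R|⁻¹·Σ_{Q_R} w`.  The skeleton's
«∃ gauge g» form is this one in the axial gauge of `T` at the box corner (✓`Prop7LatticeBoxFriedrichsCurved.norm_axial_sub_one_le_of_plaqSmall`, `β = 2dR·β_plaq`).
[cite: Balaban1983RegularityDecay, (2.27) p.580; Balaban1985Averaging, pp.24-25, (56) p.27] -/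
theorem sum_sq_sub_mean_le_box_cov {z : Zd d} {R : ℤ} (hR : 0 ≤ R) {β : ℝ}
    (T : Zd d → Fin d → (Matrix (Fin N) (Fin N) ℂ)ˣ) (hT : ∀ y μ, T y μ ∈ U1 (Matrix (Fin N) (Fin N) ℂ))
    (hTβ : ∀ (y : Zd d) (μ : Fin d), y ∈ box z R → y + unitVec μ ∈ box z R → ‖(T y μ : Matrix (Fin N) (Fin N) ℂ) - 1‖ ≤ β)
    (w : Zd d → Matrix (Fin N) (Fin N) ℂ) :
    ∑ y ∈ box z R, ‖w y - (((box z R).card : ℝ) : ℂ)⁻¹ • ∑ x ∈ box z R, w x‖ ^ 2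
      ≤ N * ((R : ℝ) * (2 * R + 1)) *
        (2 * ∑ y ∈ box z R, ∑ μ, (if y + unitVec μ ∈ box z R then ‖conjR (T y μ) (w (y + unitVec μ)) - w y‖ ^ 2 else 0)
          + 8 * d * β ^ 2 * ∑ y ∈ box z R, ‖w y‖ ^ 2) := by
  classical
  have hflat := sum_sq_sub_mean_le_box_matrix (z := z) hR w (N := N)
  -- termwise: flat difference ≤ covariant difference + transport defect
  have ht : ∀ y ∈ box z R, ∀ μ : Fin d,
      (if y + unitVec μ ∈ box z R then ‖w (y + unitVec μ) - w y‖ ^ 2 else (0 : ℝ))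
        ≤ 2 * (if y + unitVec μ ∈ box z R then ‖conjR (T y μ) (w (y + unitVec μ)) - w y‖ ^ 2 else 0)
          + 8 * β ^ 2 * (if y + unitVec μ ∈ box z R then ‖w (y + unitVec μ)‖ ^ 2 else 0) := by
    intro y hy μ
    split_ifs with hin
    · have hdef : ‖conjR (T y μ) (w (y + unitVec μ)) - w (y + unitVec μ)‖ ≤ 2 * β * ‖w (y + unitVec μ)‖ := by
        calc _ ≤ 2 * ‖(T y μ : Matrix (Fin N) (Fin N) ℂ) - 1‖ * ‖w (y + unitVec μ)‖ := norm_conjR_sub_self_le (hT y μ) _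
          _ ≤ 2 * β * ‖w (y + unitVec μ)‖ := by
              have := hTβ y μ hy hin
              have hn : 0 ≤ ‖w (y + unitVec μ)‖ := norm_nonneg _
              nlinarith
      have hid : w (y + unitVec μ) - w y = (conjR (T y μ) (w (y + unitVec μ)) - w y) - (conjR (T y μ) (w (y + unitVec μ)) - w (y + unitVec μ)) := by abel
      have h1 : ‖w (y + unitVec μ) - w y‖ ≤ ‖conjR (T y μ) (w (y + unitVec μ)) - w y‖ + 2 * β * ‖w (y + unitVec μ)‖ := by
        rw [hid]; exact (norm_sub_le _ _).trans (add_le_add le_rfl hdef)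
      have h0 : 0 ≤ ‖w (y + unitVec μ) - w y‖ := norm_nonneg _
      have h2 := pow_le_pow_left₀ h0 h1 2
      nlinarith [sq_nonneg (‖conjR (T y μ) (w (y + unitVec μ)) - w y‖ - 2 * β * ‖w (y + unitVec μ)‖)]
    · simp
  have hshift : ∑ y ∈ box z R, ∑ μ, (if y + unitVec μ ∈ box z R then ‖w (y + unitVec μ)‖ ^ 2 else (0 : ℝ)) ≤ d * ∑ y ∈ box z R, ‖w y‖ ^ 2 := by
    rw [Finset.sum_comm]
    calc ∑ μ : Fin d, ∑ y ∈ box z R, (if y + unitVec μ ∈ box z R then ‖w (y + unitVec μ)‖ ^ 2 else (0 : ℝ))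
        ≤ ∑ _μ : Fin d, ∑ y ∈ box z R, ‖w y‖ ^ 2 := Finset.sum_le_sum fun μ _ => by
          have := sum_box_shift_le (z := z) (R := R) (H := fun x => if x ∈ box z R then ‖w x‖ ^ 2 else 0)
            (fun x => by positivity) (fun x hx => if_neg hx) (unitVec μ)
          refine this.trans (le_of_eq (Finset.sum_congr rfl fun y hy => if_pos hy))
      _ = d * ∑ y ∈ box z R, ‖w y‖ ^ 2 := by simp
  have hsum : ∑ y ∈ box z R, ∑ μ, (if y + unitVec μ ∈ box z R then ‖w (y + unitVec μ) - w y‖ ^ 2 else (0 : ℝ))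
      ≤ 2 * ∑ y ∈ box z R, ∑ μ, (if y + unitVec μ ∈ box z R then ‖conjR (T y μ) (w (y + unitVec μ)) - w y‖ ^ 2 else 0)
        + 8 * β ^ 2 * (d * ∑ y ∈ box z R, ‖w y‖ ^ 2) := by
    calc _ ≤ ∑ y ∈ box z R, ∑ μ, (2 * (if y + unitVec μ ∈ box z R then ‖conjR (T y μ) (w (y + unitVec μ)) - w y‖ ^ 2 else 0)
          + 8 * β ^ 2 * (if y + unitVec μ ∈ box z R then ‖w (y + unitVec μ)‖ ^ 2 else 0)) :=
          Finset.sum_le_sum fun y hy => Finset.sum_le_sum fun μ _ => ht y hy μ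
      _ = 2 * ∑ y ∈ box z R, ∑ μ, (if y + unitVec μ ∈ box z R then ‖conjR (T y μ) (w (y + unitVec μ)) - w y‖ ^ 2 else 0)
          + 8 * β ^ 2 * ∑ y ∈ box z R, ∑ μ, (if y + unitVec μ ∈ box z R then ‖w (y + unitVec μ)‖ ^ 2 else (0 : ℝ)) := by
          simp only [Finset.sum_add_distrib, Finset.mul_sum]
      _ ≤ _ := by
          have : 0 ≤ 8 * β ^ 2 := by positivity
          nlinarith [hshift]
  have hR' : (0 : ℝ) ≤ (R : ℝ) := by exact_mod_cast hR
  have hRR : (0 : ℝ) ≤ N * ((R : ℝ) * (2 * R + 1)) := by positivity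
  refine hflat.trans ((mul_le_mul_of_nonneg_left hsum hRR).trans (le_of_eq ?_))
  ring

end Covariant

end Summit.QuantumFields.YangMills.Theorems.Prop7LatticeBoxPoincareCov

end
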